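import Literature.Analysis.FluidPDE.BesovDuhamelBlocks
import Mathlib.MeasureTheory.Integral.Gamma
import Mathlib.Analysis.SpecialFunctions.Gaussian.GaussianIntegral
import HarnessLib

/-!
# Estimates for the blocks of the Navier–Stokes Duhamel term: kernel sizes, time integrals, profiles

Analysis/FluidPDE proof file (no definitions, no named facts), continuing `OseenKernelBlocks.lean`
and `BesovDuhamelBlocks.lean` (which reduce `‖Δ̇_j B(u,v)(t)‖_{L^p}` to
`∫₀ᵗ ‖m_j(t-s)‖_{L¹} N(s) ds` with the scalar majorant `m_j(σ) = ∑_{k,l}‖Δ̇_j K(σ,·)[e_k,e_l]‖` of the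
blocked Oseen–Koch–Tataru kernel and a weight `N` dominating `‖|u(s)||v(s)|‖_{L^p}`). It supplies the
real-variable estimates that turn this into the `ℓ¹ ∩ ℓ^∞` block profile of the Besov regularity of
the Duhamel term (Bahouri–Chemin–Danchin 2011, proof of Thm. 5.40; Gallagher–Koch–Planchon 2016,
App. B), everything **proved**:

* `§ MajorantSize`: `∫ m_j(σ) ≤ d² B` from a bound `B` on unit directions
  (`lintegral_enorm_sum_blockFn_oseenKernel_le`), hence the **low-frequency size**
  `∫ m_j(σ) ≤ C 2^{jθ} σ^{(θ-1)/2}` (`exists_lintegral_majorant_le_low`, `0 ≤ θ < 1`, any dimension)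
  and the **high-frequency size** `∫ m_j(σ) ≤ C e^{-cσ2^{2j}} σ^{-1/2}`
  (`exists_lintegral_majorant_le_high`, on `ℝ^ι`), from the two kernel bounds of
  `OseenKernelBlocks.lean`;
* `§ TimeIntegrals` (in `ℝ≥0∞`, the form consumed by the Minkowski bound): with Kato's weight
  `M s^{-γ}`, `0 ≤ γ < 1`: `∫₀ᵗ A2^{jθ}(t-s)^{(θ-1)/2} Ms^{-γ} ds = A M I 2^{jθ} t^{(θ+1)/2-γ}`
  (`lintegral_Ioo_low_kato`, the Beta integral of `KatoBilinearEstimates.lean`) and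
  `∫₀ᵗ Ae^{-c(t-s)4^j}(t-s)^{-1/2} Ms^{-γ} ds ≤ A M [e^{-ct4^j/2}(t/2)^{1/2-γ}/(1-γ) + (t/2)^{-γ}√π(c4^j)^{-1/2}]`
  (`lintegral_Ioo_high_kato_le`: split at `t/2`, reflect `s ↦ t-s`, extend to the half line, and
  `∫₀^∞ σ^{-1/2}e^{-bσ}dσ = √π b^{-1/2}`, `lintegral_Ioi_exp_neg_mul_rpow_neg_half`, from Mathlib's
  `integral_rpow_mul_exp_neg_mul_rpow` and `Γ(1/2) = √π`); with a constant weight on `(t₀, t)` (the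
  short-time pieces of the restart identity): `lintegral_Ioo_low_const`
  (`= A M (2/(θ+1)) 2^{jθ}(t-t₀)^{(θ+1)/2}`), `lintegral_Ioo_high_const_le_sqrt` (`≤ 2AM(t-t₀)^{1/2}`)
  and `lintegral_Ioo_high_const_le_gamma` (`≤ A M √π (c4^j)^{-1/2}`);
* `§ DyadicProfile`: `∑_{j∈ℤ} h(4^jt) ≤ K < ∞` uniformly in `t > 0` for profiles with `h(x) ≤ x^a`
  (`x ≥ 0`) and `h(x) ≤ Mx^{-b}` (`x ≥ 1`), `a, b > 0` (`exists_tsum_dyadic_profile_le`, the power-decay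
  twin of `FunctionSpaces.exists_tsum_rpow_mul_exp_neg_le`).

With `s = -1 + 3/p`, `γ = 1 - 3/(2p) = (1-s)/2` and `θ = γ`, the two regimes give
`2^{js}‖Δ̇_j B(u,u)(t)‖_{L^p} ≲ ab · min((4^jt)^{(s+θ)/2}, (4^jt)^{s/2}e^{-c4^jt/2} + (4^jt)^{-γ})`, whose
dyadic sums are bounded uniformly in `t`: the `Ḃ^{-1+3/p}_{p,1}` bound of the Duhamel term required by
`exists_isBesovMildSolutionOn_of_duhamel` (`BesovMildAssembly.lean`).

## References

* H. Bahouri, J.-Y. Chemin, R. Danchin, *Fourier Analysis and Nonlinear PDE* (2011), Thm. 5.40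
  (proof), Lemma 2.4. [BahouriCheminDanchin2011]
* I. Gallagher, G. S. Koch, F. Planchon, Comm. Math. Phys. 343 (2016) = arXiv:1407.4156, App. B.
  [GKP2016]
* T. Kato, Math. Z. 187 (1984), §2, (2.3)–(2.5). [Kato1984]
-/

noncomputable section

open MeasureTheory Set Function Filter
open _root_.Topology
open scoped SchwartzMap ENNReal NNReal RealInnerProductSpace Convolution

namespace Literature.Analysis.FluidPDE

open FunctionSpaces (blockFn blockKernel)

/-! ## The `L¹` size of the scalar majorant -/

section MajorantSize

variable {E : Type*} [NormedAddCommGroup E] [InnerProductSpace ℝ E] [FiniteDimensional ℝ E]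
  [MeasurableSpace E] [BorelSpace E]

/-- **The `L¹` norm of the scalar majorant**: if `∫‖Δ̇_j K(σ,·)[a,b]‖ ≤ B` for all unit directions
`a`, `b`, then `∫ m_j(σ) ≤ d² B`, `m_j(σ) = ∑_{k,l}‖Δ̇_j K(σ,·)[e_k,e_l]‖`. [folklore] -/
theorem lintegral_enorm_sum_blockFn_oseenKernel_le (j : ℤ) (σ : ℝ) {B : ℝ≥0∞}
    (hB : ∀ a b : E, ‖a‖ ≤ 1 → ‖b‖ ≤ 1 → ∫⁻ y, ‖blockFn j (fun w => oseenKernel σ w a b) y‖ₑ ≤ B) :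
    ∫⁻ y, ‖∑ k, ∑ l, ‖blockFn j (fun w => oseenKernel σ w (stdOrthonormalBasis ℝ E k)
        (stdOrthonormalBasis ℝ E l)) y‖‖ₑ ≤ (Module.finrank ℝ E : ℝ≥0∞) ^ 2 * B := by
  set e := stdOrthonormalBasis ℝ E with he
  have hpt : ∀ y, ‖∑ k, ∑ l, ‖blockFn j (fun w => oseenKernel σ w (e k) (e l)) y‖‖ₑ =
      ∑ k, ∑ l, ‖blockFn j (fun w => oseenKernel σ w (e k) (e l)) y‖ₑ := by
    intro y
    rw [Real.enorm_eq_ofReal (Finset.sum_nonneg fun k _ => Finset.sum_nonneg fun l _ => norm_nonneg _),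
      ENNReal.ofReal_sum_of_nonneg (fun k _ => Finset.sum_nonneg fun l _ => norm_nonneg _)]
    refine Finset.sum_congr rfl fun k _ => ?_
    rw [ENNReal.ofReal_sum_of_nonneg (fun l _ => norm_nonneg _)]
    refine Finset.sum_congr rfl fun l _ => ?_
    rw [ofReal_norm]
  simp_rw [hpt]
  have hae : ∀ k l, AEMeasurable (fun y => ‖blockFn j (fun w => oseenKernel σ w (e k) (e l)) y‖ₑ)
      volume := fun k l => (aestronglyMeasurable_blockFn_oseenKernel (E := E) j σ (e k) (e l)).enorm
  have h1 : ∫⁻ y, ∑ k, ∑ l, ‖blockFn j (fun w => oseenKernel σ w (e k) (e l)) y‖ₑ =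
      ∑ k, ∑ l, ∫⁻ y, ‖blockFn j (fun w => oseenKernel σ w (e k) (e l)) y‖ₑ := by
    rw [lintegral_finsetSum' _ fun k _ => Finset.aemeasurable_fun_sum _ fun l _ => hae k l]
    refine Finset.sum_congr rfl fun k _ => ?_
    rw [lintegral_finsetSum' _ fun l _ => hae k l]
  rw [h1]
  have hunit : ∀ k, ‖e k‖ ≤ 1 := fun k => (e.orthonormal.1 k).le
  calc ∑ k, ∑ l, ∫⁻ y, ‖blockFn j (fun w => oseenKernel σ w (e k) (e l)) y‖ₑ
      ≤ ∑ k : Fin (Module.finrank ℝ E), ∑ l : Fin (Module.finrank ℝ E), B :=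
        Finset.sum_le_sum fun k _ => Finset.sum_le_sum fun l _ => hB _ _ (hunit k) (hunit l)
    _ = (Module.finrank ℝ E : ℝ≥0∞) ^ 2 * B := by
        simp only [Finset.sum_const, Finset.card_univ, Fintype.card_fin, nsmul_eq_mul]
        ring

/-- **Low-frequency size of the majorant** (from `exists_lintegral_enorm_oseenKernelBlock_le_low`):
`∫ m_j(σ) ≤ d² C 2^{jθ} σ^{(θ-1)/2}`, `0 ≤ θ < 1`. [cite: KochTataruAdvMath2001, §2 (8) and (14)] -/
theorem exists_lintegral_majorant_le_low {θ : ℝ} (hθ0 : 0 ≤ θ) (hθ1 : θ < 1) :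
    ∃ C : ℝ, 0 ≤ C ∧ ∀ (j : ℤ) {σ : ℝ}, 0 < σ →
      ∫⁻ y, ‖∑ k, ∑ l, ‖blockFn j (fun w => oseenKernel σ w (stdOrthonormalBasis ℝ E k)
          (stdOrthonormalBasis ℝ E l)) y‖‖ₑ ≤
        ENNReal.ofReal (C * (2 : ℝ) ^ ((j : ℝ) * θ) * σ ^ ((θ - 1) / 2)) := by
  obtain ⟨C, hC0, hC⟩ := exists_lintegral_enorm_oseenKernelBlock_le_low (E := E) hθ0 hθ1
  refine ⟨(Module.finrank ℝ E : ℝ) ^ 2 * C, by positivity, fun j {σ} hσ => ?_⟩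
  refine (lintegral_enorm_sum_blockFn_oseenKernel_le j σ (B := ENNReal.ofReal
    (C * (2 : ℝ) ^ ((j : ℝ) * θ) * σ ^ ((θ - 1) / 2))) fun a b ha hb => ?_).trans (le_of_eq ?_)
  · refine (hC j hσ a b).trans (ENNReal.ofReal_le_ofReal ?_)
    have h0 : 0 ≤ C * (2 : ℝ) ^ ((j : ℝ) * θ) * σ ^ ((θ - 1) / 2) := by positivity
    calc C * (2 : ℝ) ^ ((j : ℝ) * θ) * σ ^ ((θ - 1) / 2) * ‖a‖ * ‖b‖
        ≤ C * (2 : ℝ) ^ ((j : ℝ) * θ) * σ ^ ((θ - 1) / 2) * 1 * 1 := by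
          gcongr
      _ = _ := by ring
  · have hd : ((Module.finrank ℝ E : ℝ≥0∞)) ^ 2 = ENNReal.ofReal ((Module.finrank ℝ E : ℝ) ^ 2) := by
      rw [ENNReal.ofReal_pow (Nat.cast_nonneg _), ENNReal.ofReal_natCast]
    rw [hd, ← ENNReal.ofReal_mul (by positivity)]
    congr 1; ring

end MajorantSize

section MajorantSizeHigh

variable {ι : Type*} [Fintype ι]

/-- **High-frequency size of the majorant** on `ℝ^ι`
(from `exists_lintegral_enorm_oseenKernelBlock_le_high`): `∫ m_j(σ) ≤ d² C e^{-cσ2^{2j}} σ^{-1/2}`.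
[cite: GKP2016, App. B (heat estimate)] -/
theorem exists_lintegral_majorant_le_high :
    ∃ (C c : ℝ), 0 ≤ C ∧ 0 < c ∧ ∀ (j : ℤ) {σ : ℝ}, 0 < σ →
      ∫⁻ y, ‖∑ k, ∑ l, ‖blockFn j (fun w => oseenKernel σ w
          (stdOrthonormalBasis ℝ (EuclideanSpace ℝ ι) k)
          (stdOrthonormalBasis ℝ (EuclideanSpace ℝ ι) l)) y‖‖ₑ ≤
        ENNReal.ofReal (C * Real.exp (-(c * σ * 2 ^ (2 * j))) * σ ^ (-(1 / 2 : ℝ))) := by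
  obtain ⟨C, c, hC0, hc, hC⟩ := exists_lintegral_enorm_oseenKernelBlock_le_high (ι := ι)
  set d : ℕ := Module.finrank ℝ (EuclideanSpace ℝ ι) with hd
  refine ⟨(d : ℝ) ^ 2 * C, c, by positivity, hc, fun j {σ} hσ => ?_⟩
  refine (lintegral_enorm_sum_blockFn_oseenKernel_le j σ (B := ENNReal.ofReal
    (C * Real.exp (-(c * σ * 2 ^ (2 * j))) * σ ^ (-(1 / 2 : ℝ)))) fun a b ha hb => ?_).trans
    (le_of_eq ?_)
  · refine (hC j hσ a b).trans (ENNReal.ofReal_le_ofReal ?_)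
    have h0 : 0 ≤ C * Real.exp (-(c * σ * 2 ^ (2 * j))) * σ ^ (-(1 / 2 : ℝ)) := by
      have := Real.rpow_nonneg hσ.le (-(1 / 2 : ℝ)); positivity
    calc C * Real.exp (-(c * σ * 2 ^ (2 * j))) * σ ^ (-(1 / 2 : ℝ)) * ‖a‖ * ‖b‖
        ≤ C * Real.exp (-(c * σ * 2 ^ (2 * j))) * σ ^ (-(1 / 2 : ℝ)) * 1 * 1 := by
          gcongr
      _ = _ := by ring
  · have hdc : ((d : ℝ≥0∞)) ^ 2 = ENNReal.ofReal ((d : ℝ) ^ 2) := by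
      rw [ENNReal.ofReal_pow (Nat.cast_nonneg _), ENNReal.ofReal_natCast]
    rw [← hd, hdc, ← ENNReal.ofReal_mul (by positivity)]
    congr 1; ring

end MajorantSizeHigh

/-! ## The weighted time integrals -/

section TimeIntegrals

/-- **Low-frequency time integral with Kato's weight**: for `0 ≤ θ < 1`, `0 ≤ γ < 1`, `A, M ≥ 0`,
`t > 0`: `∫₀ᵗ A 2^{jθ}(t-s)^{(θ-1)/2} · M s^{-γ} ds = A M I 2^{jθ} t^{(θ+1)/2-γ}`,
`I = ∫₀¹(1-r)^{(θ-1)/2}r^{-γ}dr` (the Beta integral of `KatoBilinearEstimates.lean`). [folklore] -/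
theorem lintegral_Ioo_low_kato {θ γ A M t : ℝ} (hθ0 : 0 ≤ θ) (hθ1 : θ < 1) (hγ0 : 0 ≤ γ)
    (hγ1 : γ < 1) (hA : 0 ≤ A) (hM : 0 ≤ M) (ht : 0 < t) (j : ℤ) :
    ∫⁻ s in Ioo 0 t, ENNReal.ofReal (A * (2 : ℝ) ^ ((j : ℝ) * θ) * (t - s) ^ ((θ - 1) / 2)) *
        ENNReal.ofReal (M * s ^ (-γ)) =
      ENNReal.ofReal (A * M * (∫ r in (0 : ℝ)..1, (1 - r) ^ (-((1 - θ) / 2)) * r ^ (-γ)) *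
        (2 : ℝ) ^ ((j : ℝ) * θ) * t ^ ((θ + 1) / 2 - γ)) := by
  have ha0 : 0 ≤ (1 - θ) / 2 := by linarith
  have ha1 : (1 - θ) / 2 < 1 := by linarith
  have h := lintegral_Ioo_ofReal_sub_rpow_mul_rpow ha0 ha1 hγ0 hγ1
    (c := A * (2 : ℝ) ^ ((j : ℝ) * θ) * M) (by positivity) ht
  have heq : ∀ s ∈ Ioo 0 t, ENNReal.ofReal (A * (2 : ℝ) ^ ((j : ℝ) * θ) * (t - s) ^ ((θ - 1) / 2)) *
      ENNReal.ofReal (M * s ^ (-γ)) =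
      ENNReal.ofReal (A * (2 : ℝ) ^ ((j : ℝ) * θ) * M * ((t - s) ^ (-((1 - θ) / 2)) * s ^ (-γ))) := by
    intro s hs
    rw [← ENNReal.ofReal_mul (by
      have := Real.rpow_nonneg (sub_pos.2 hs.2).le ((θ - 1) / 2); positivity),
      show -((1 - θ) / 2) = (θ - 1) / 2 by ring]
    congr 1; ring
  rw [setLIntegral_congr_fun measurableSet_Ioo heq, h]
  congr 1
  rw [show (1 : ℝ) - (1 - θ) / 2 - γ = (θ + 1) / 2 - γ by ring]
  ring

/-- **Low-frequency time integral with a constant weight** on `(t₀, t)`: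
`∫_{t₀}^t A 2^{jθ}(t-s)^{(θ-1)/2} · M ds = A M (2/(θ+1)) 2^{jθ} (t-t₀)^{(θ+1)/2}`. [folklore] -/
theorem lintegral_Ioo_low_const {θ A M t₀ t : ℝ} (hθ0 : 0 ≤ θ) (hA : 0 ≤ A)
    (hM : 0 ≤ M) (ht : t₀ < t) (j : ℤ) :
    ∫⁻ s in Ioo t₀ t, ENNReal.ofReal (A * (2 : ℝ) ^ ((j : ℝ) * θ) * (t - s) ^ ((θ - 1) / 2)) *
        ENNReal.ofReal M =
      ENNReal.ofReal (A * M * (2 / (θ + 1)) * (2 : ℝ) ^ ((j : ℝ) * θ) * (t - t₀) ^ ((θ + 1) / 2)) := by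
  have hr : -1 < (θ - 1) / 2 := by linarith
  -- the power integral `∫_{t₀}^t (t-s)^{(θ-1)/2} ds = (t-t₀)^{(θ+1)/2} / ((θ+1)/2)`
  have hint : ∫ s in Ioo t₀ t, (t - s) ^ ((θ - 1) / 2) = (t - t₀) ^ ((θ + 1) / 2) / ((θ + 1) / 2) := by
    rw [← integral_Ioc_eq_integral_Ioo, ← intervalIntegral.integral_of_le ht.le]
    have h := intervalIntegral.integral_comp_sub_left (fun r : ℝ => r ^ ((θ - 1) / 2)) (a := t₀)
      (b := t) t
    rw [h, sub_self, integral_rpow (Or.inl hr)]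
    rw [show (θ - 1) / 2 + 1 = (θ + 1) / 2 by ring, Real.zero_rpow (by linarith), sub_zero]
  have hii : IntervalIntegrable (fun s : ℝ => (t - s) ^ ((θ - 1) / 2)) volume t₀ t := by
    have h := (intervalIntegral.intervalIntegrable_rpow' (a := 0) (b := t - t₀) hr).comp_sub_left t
    simp only [sub_zero, sub_sub_cancel] at h
    exact h.symm
  have hio : IntegrableOn (fun s : ℝ => (t - s) ^ ((θ - 1) / 2)) (Ioo t₀ t) := by
    rw [← intervalIntegrable_iff_integrableOn_Ioo_of_le ht.le]; exact hii
  have heq : ∀ s ∈ Ioo t₀ t, ENNReal.ofReal (A * (2 : ℝ) ^ ((j : ℝ) * θ) * (t - s) ^ ((θ - 1) / 2)) *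
      ENNReal.ofReal M =
      ENNReal.ofReal ((A * (2 : ℝ) ^ ((j : ℝ) * θ) * M) * (t - s) ^ ((θ - 1) / 2)) := by
    intro s hs
    rw [← ENNReal.ofReal_mul (by
      have := Real.rpow_nonneg (sub_pos.2 hs.2).le ((θ - 1) / 2); positivity)]
    congr 1; ring
  rw [setLIntegral_congr_fun measurableSet_Ioo heq,
    ← ofReal_integral_eq_lintegral_ofReal (hio.const_mul _)
      ((ae_restrict_iff' measurableSet_Ioo).2 (Eventually.of_forall fun s hs =>
        mul_nonneg (by positivity) (Real.rpow_nonneg (sub_pos.2 hs.2).le _))),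
    integral_const_mul, hint]
  congr 1
  field_simp

/-- `∫₀^∞ σ^{-1/2} e^{-bσ} dσ = √π b^{-1/2}` in the form `∫⁻_{(0,∞)} ofReal(e^{-bσ}σ^{-1/2}) = ofReal(√π b^{-1/2})`.
[folklore] -/
theorem lintegral_Ioi_exp_neg_mul_rpow_neg_half {b : ℝ} (hb : 0 < b) :
    ∫⁻ σ in Ioi (0 : ℝ), ENNReal.ofReal (Real.exp (-(b * σ)) * σ ^ (-(1 / 2 : ℝ))) =
      ENNReal.ofReal (Real.sqrt Real.pi * b ^ (-(1 / 2 : ℝ))) := by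
  have hq : (-1 : ℝ) < -(1 / 2 : ℝ) := by norm_num
  have hint := integrableOn_rpow_mul_exp_neg_mul_rpow (s := -(1 / 2 : ℝ)) (p := 1) hq le_rfl hb
  have hval := integral_rpow_mul_exp_neg_mul_rpow (p := 1) (q := -(1 / 2 : ℝ)) one_pos hq hb
  have heqf : ∀ σ ∈ Ioi (0 : ℝ), Real.exp (-(b * σ)) * σ ^ (-(1 / 2 : ℝ)) =
      σ ^ (-(1 / 2 : ℝ)) * Real.exp (-b * σ ^ (1 : ℝ)) := by
    intro σ _
    rw [Real.rpow_one, mul_comm, neg_mul]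
  rw [setLIntegral_congr_fun measurableSet_Ioi (fun σ hσ => by rw [heqf σ hσ]),
    ← ofReal_integral_eq_lintegral_ofReal hint
      ((ae_restrict_iff' measurableSet_Ioi).2 (Eventually.of_forall fun σ hσ =>
        mul_nonneg (Real.rpow_nonneg (le_of_lt hσ) _) (Real.exp_pos _).le)), hval]
  congr 1
  rw [show (-(-(1 / 2 : ℝ) + 1) / 1) = -(1 / 2 : ℝ) by norm_num,
    show ((-(1 / 2 : ℝ) + 1) / 1) = 1 / 2 by norm_num, Real.Gamma_one_half_eq]
  ring

/-- **High-frequency time integral with a constant weight, smallness form**: dropping the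
exponential, `∫_{t₀}^t A e^{-c(t-s)4^j}(t-s)^{-1/2} · M ds ≤ 2 A M (t-t₀)^{1/2}`. [folklore] -/
theorem lintegral_Ioo_high_const_le_sqrt {c A M t₀ t : ℝ} (hc : 0 ≤ c) (hA : 0 ≤ A) (hM : 0 ≤ M)
    (ht : t₀ < t) (j : ℤ) :
    ∫⁻ s in Ioo t₀ t, ENNReal.ofReal (A * Real.exp (-(c * (t - s) * 2 ^ (2 * j))) *
        (t - s) ^ (-(1 / 2 : ℝ))) * ENNReal.ofReal M ≤
      ENNReal.ofReal (2 * A * M * (t - t₀) ^ (1 / 2 : ℝ)) := by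
  have hr : -1 < -(1 / 2 : ℝ) := by norm_num
  have hint : ∫ s in Ioo t₀ t, (t - s) ^ (-(1 / 2 : ℝ)) = 2 * (t - t₀) ^ (1 / 2 : ℝ) := by
    rw [← integral_Ioc_eq_integral_Ioo, ← intervalIntegral.integral_of_le ht.le]
    have h := intervalIntegral.integral_comp_sub_left (fun r : ℝ => r ^ (-(1 / 2 : ℝ))) (a := t₀)
      (b := t) t
    rw [h, sub_self, integral_rpow (Or.inl hr)]
    rw [show -(1 / 2 : ℝ) + 1 = 1 / 2 by norm_num, Real.zero_rpow (by norm_num), sub_zero]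
    ring
  have hio : IntegrableOn (fun s : ℝ => (t - s) ^ (-(1 / 2 : ℝ))) (Ioo t₀ t) := by
    rw [← intervalIntegrable_iff_integrableOn_Ioo_of_le ht.le]
    have h := (intervalIntegral.intervalIntegrable_rpow' (a := 0) (b := t - t₀) hr).comp_sub_left t
    simp only [sub_zero, sub_sub_cancel] at h
    exact h.symm
  have hpt : ∀ s ∈ Ioo t₀ t, ENNReal.ofReal (A * Real.exp (-(c * (t - s) * 2 ^ (2 * j))) *
      (t - s) ^ (-(1 / 2 : ℝ))) * ENNReal.ofReal M ≤ ENNReal.ofReal ((A * M) * (t - s) ^ (-(1 / 2 : ℝ))) := by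
    intro s hs
    have hts : 0 ≤ (t - s) ^ (-(1 / 2 : ℝ)) := Real.rpow_nonneg (sub_pos.2 hs.2).le _
    rw [← ENNReal.ofReal_mul (by positivity)]
    refine ENNReal.ofReal_le_ofReal ?_
    have hexp : Real.exp (-(c * (t - s) * 2 ^ (2 * j))) ≤ 1 := by
      rw [Real.exp_le_one_iff, neg_nonpos]
      exact mul_nonneg (mul_nonneg hc (sub_pos.2 hs.2).le) (zpow_nonneg (by norm_num) _)
    calc A * Real.exp (-(c * (t - s) * 2 ^ (2 * j))) * (t - s) ^ (-(1 / 2 : ℝ)) * M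
        ≤ A * 1 * (t - s) ^ (-(1 / 2 : ℝ)) * M := by gcongr
      _ = A * M * (t - s) ^ (-(1 / 2 : ℝ)) := by ring
  calc ∫⁻ s in Ioo t₀ t, ENNReal.ofReal (A * Real.exp (-(c * (t - s) * 2 ^ (2 * j))) *
        (t - s) ^ (-(1 / 2 : ℝ))) * ENNReal.ofReal M
      ≤ ∫⁻ s in Ioo t₀ t, ENNReal.ofReal ((A * M) * (t - s) ^ (-(1 / 2 : ℝ))) :=
        setLIntegral_mono' measurableSet_Ioo hpt
    _ = ENNReal.ofReal ((A * M) * (2 * (t - t₀) ^ (1 / 2 : ℝ))) := by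
        rw [← ofReal_integral_eq_lintegral_ofReal (hio.const_mul _)
          ((ae_restrict_iff' measurableSet_Ioo).2 (Eventually.of_forall fun s hs =>
            mul_nonneg (by positivity) (Real.rpow_nonneg (sub_pos.2 hs.2).le _))),
          integral_const_mul, hint]
    _ = ENNReal.ofReal (2 * A * M * (t - t₀) ^ (1 / 2 : ℝ)) := by congr 1; ring

/-- The set identity behind the reflection `s ↦ t - s`: `(t - ·)⁻¹' (0, r] = [t - r, t)`. [folklore] -/
theorem preimage_const_sub_Ioc' (t r : ℝ) : (fun s : ℝ => t - s) ⁻¹' Ioc 0 r = Ico (t - r) t := by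
  ext s
  simp only [mem_preimage, mem_Ioc, mem_Ico, sub_pos]
  constructor
  · rintro ⟨h1, h2⟩; exact ⟨by linarith, h1⟩
  · rintro ⟨h1, h2⟩; exact ⟨h2, by linarith⟩

/-- **High-frequency time integral with a constant weight, decay form**: extending to the half
line, `∫_{t₀}^t A e^{-c(t-s)4^j}(t-s)^{-1/2} · M ds ≤ A M √π (c2^{2j})^{-1/2}` (`= A M √(π/c) 2^{-j}`).
[folklore] -/
theorem lintegral_Ioo_high_const_le_gamma {c A M t₀ t : ℝ} (hc : 0 < c) (hA : 0 ≤ A) (hM : 0 ≤ M)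
    (j : ℤ) :
    ∫⁻ s in Ioo t₀ t, ENNReal.ofReal (A * Real.exp (-(c * (t - s) * 2 ^ (2 * j))) *
        (t - s) ^ (-(1 / 2 : ℝ))) * ENNReal.ofReal M ≤
      ENNReal.ofReal (A * M * (Real.sqrt Real.pi * (c * 2 ^ (2 * j)) ^ (-(1 / 2 : ℝ)))) := by
  set b : ℝ := c * 2 ^ (2 * j) with hb
  have hb0 : 0 < b := mul_pos hc (zpow_pos two_pos _)
  set g : ℝ → ℝ≥0∞ := fun σ => ENNReal.ofReal (Real.exp (-(b * σ)) * σ ^ (-(1 / 2 : ℝ))) with hg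
  -- pointwise: the integrand is `ofReal (A M) * g (t - s)`
  have hpt : ∀ s ∈ Ioo t₀ t, ENNReal.ofReal (A * Real.exp (-(c * (t - s) * 2 ^ (2 * j))) *
      (t - s) ^ (-(1 / 2 : ℝ))) * ENNReal.ofReal M = ENNReal.ofReal (A * M) * g (t - s) := by
    intro s hs
    have hts : 0 ≤ (t - s) ^ (-(1 / 2 : ℝ)) := Real.rpow_nonneg (sub_pos.2 hs.2).le _
    rw [hg, ← ENNReal.ofReal_mul (by positivity), ← ENNReal.ofReal_mul (by positivity)]
    congr 1
    rw [hb, show -(c * (t - s) * 2 ^ (2 * j)) = -(c * 2 ^ (2 * j) * (t - s)) by ring]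
    ring
  rw [setLIntegral_congr_fun measurableSet_Ioo hpt, lintegral_const_mul' _ _ ENNReal.ofReal_ne_top]
  -- reflect and extend to the half line
  have hrefl : ∫⁻ s in Ioo t₀ t, g (t - s) ≤ ∫⁻ σ in Ioi (0 : ℝ), g σ := by
    calc ∫⁻ s in Ioo t₀ t, g (t - s) ≤ ∫⁻ s in Ico (t - (t - t₀)) t, g (t - s) := by
          refine lintegral_mono_set ?_
          rw [sub_sub_cancel]
          exact Ioo_subset_Ico_self
      _ = ∫⁻ σ in Ioc 0 (t - t₀), g σ := by
          rw [← preimage_const_sub_Ioc' t (t - t₀)]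
          exact (Measure.measurePreserving_sub_left volume t).setLIntegral_comp_preimage_emb
            (measurableEmbedding_subLeft t) g (Ioc 0 (t - t₀))
      _ ≤ ∫⁻ σ in Ioi (0 : ℝ), g σ := lintegral_mono_set Ioc_subset_Ioi_self
  calc ENNReal.ofReal (A * M) * ∫⁻ s in Ioo t₀ t, g (t - s)
      ≤ ENNReal.ofReal (A * M) * ∫⁻ σ in Ioi (0 : ℝ), g σ := mul_le_mul_right hrefl _
    _ = ENNReal.ofReal (A * M) * ENNReal.ofReal (Real.sqrt Real.pi * b ^ (-(1 / 2 : ℝ))) := by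
        rw [hg, lintegral_Ioi_exp_neg_mul_rpow_neg_half hb0]
    _ = ENNReal.ofReal (A * M * (Real.sqrt Real.pi * (c * 2 ^ (2 * j)) ^ (-(1 / 2 : ℝ)))) := by
        rw [← ENNReal.ofReal_mul (by positivity), hb]

/-- **High-frequency time integral with Kato's weight**: for `c > 0`, `0 ≤ γ < 1`, `A, M ≥ 0`, `t > 0`,
`∫₀ᵗ A e^{-c(t-s)4^j}(t-s)^{-1/2} · M s^{-γ} ds
  ≤ A M [e^{-c(t/2)4^j} (t/2)^{-1/2} (t/2)^{1-γ}/(1-γ) + (t/2)^{-γ} √π (c4^j)^{-1/2}]`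
(split at `s = t/2`: on `(0, t/2)` the kernel factor is monotone, on `[t/2, t)` the weight is, and
the kernel integral extends to the half line). [folklore] -/
theorem lintegral_Ioo_high_kato_le {c γ A M t : ℝ} (hc : 0 < c) (hγ0 : 0 ≤ γ) (hγ1 : γ < 1)
    (hA : 0 ≤ A) (hM : 0 ≤ M) (ht : 0 < t) (j : ℤ) :
    ∫⁻ s in Ioo 0 t, ENNReal.ofReal (A * Real.exp (-(c * (t - s) * 2 ^ (2 * j))) *
        (t - s) ^ (-(1 / 2 : ℝ))) * ENNReal.ofReal (M * s ^ (-γ)) ≤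
      ENNReal.ofReal (A * M * (Real.exp (-(c * (t / 2) * 2 ^ (2 * j))) * (t / 2) ^ (-(1 / 2 : ℝ)) *
        ((t / 2) ^ (1 - γ) / (1 - γ)) +
        (t / 2) ^ (-γ) * (Real.sqrt Real.pi * (c * 2 ^ (2 * j)) ^ (-(1 / 2 : ℝ))))) := by
  have ht2 : 0 < t / 2 := half_pos ht
  have ht2t : t / 2 ≤ t := by linarith
  set f : ℝ → ℝ≥0∞ := fun s => ENNReal.ofReal (A * Real.exp (-(c * (t - s) * 2 ^ (2 * j))) *
    (t - s) ^ (-(1 / 2 : ℝ))) * ENNReal.ofReal (M * s ^ (-γ)) with hf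
  -- ### split the domain
  have hsplit : ∫⁻ s in Ioo 0 t, f s = (∫⁻ s in Ioo 0 (t / 2), f s) + ∫⁻ s in Ico (t / 2) t, f s := by
    rw [← Ioo_union_Ico_eq_Ioo ht2 ht2t, lintegral_union measurableSet_Ico]
    exact Set.disjoint_left.2 fun s hs hs' => (not_le.2 hs.2) hs'.1
  -- ### part A: `s < t/2`
  set KA : ℝ := A * Real.exp (-(c * (t / 2) * 2 ^ (2 * j))) * (t / 2) ^ (-(1 / 2 : ℝ)) with hKA
  have hKA0 : 0 ≤ KA := by have := Real.rpow_nonneg ht2.le (-(1 / 2 : ℝ)); positivity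
  have hptA : ∀ s ∈ Ioo 0 (t / 2), f s ≤ ENNReal.ofReal (KA * M * s ^ (-γ)) := by
    intro s hs
    have hts : t / 2 ≤ t - s := by linarith [hs.2]
    have hts0 : 0 < t - s := ht2.trans_le hts
    have h1 : Real.exp (-(c * (t - s) * 2 ^ (2 * j))) ≤ Real.exp (-(c * (t / 2) * 2 ^ (2 * j))) := by
      rw [Real.exp_le_exp, neg_le_neg_iff]
      have : 0 ≤ c * 2 ^ (2 * j) := mul_nonneg hc.le (zpow_nonneg (by norm_num) _)
      nlinarith
    have h2 : (t - s) ^ (-(1 / 2 : ℝ)) ≤ (t / 2) ^ (-(1 / 2 : ℝ)) :=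
      Real.rpow_le_rpow_of_nonpos ht2 hts (by norm_num)
    simp only [hf]
    rw [← ENNReal.ofReal_mul (by have := Real.rpow_nonneg hts0.le (-(1 / 2 : ℝ)); positivity)]
    refine ENNReal.ofReal_le_ofReal ?_
    have hsγ : 0 ≤ M * s ^ (-γ) := mul_nonneg hM (Real.rpow_nonneg hs.1.le _)
    calc A * Real.exp (-(c * (t - s) * 2 ^ (2 * j))) * (t - s) ^ (-(1 / 2 : ℝ)) * (M * s ^ (-γ))
        ≤ A * Real.exp (-(c * (t / 2) * 2 ^ (2 * j))) * (t / 2) ^ (-(1 / 2 : ℝ)) * (M * s ^ (-γ)) := by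
          gcongr
      _ = KA * M * s ^ (-γ) := by rw [hKA]; ring
  have hr : -1 < -γ := by linarith
  have hintA : ∫ s in Ioo 0 (t / 2), s ^ (-γ) = (t / 2) ^ (1 - γ) / (1 - γ) := by
    rw [← integral_Ioc_eq_integral_Ioo, ← intervalIntegral.integral_of_le ht2.le, integral_rpow (Or.inl hr),
      Real.zero_rpow (by linarith), sub_zero, show -γ + 1 = 1 - γ by ring]
  have hioA : IntegrableOn (fun s : ℝ => s ^ (-γ)) (Ioo 0 (t / 2)) := by
    rw [← intervalIntegrable_iff_integrableOn_Ioo_of_le ht2.le]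
    exact intervalIntegral.intervalIntegrable_rpow' hr
  have hpartA : ∫⁻ s in Ioo 0 (t / 2), f s ≤ ENNReal.ofReal (KA * M * ((t / 2) ^ (1 - γ) / (1 - γ))) := by
    calc ∫⁻ s in Ioo 0 (t / 2), f s ≤ ∫⁻ s in Ioo 0 (t / 2), ENNReal.ofReal (KA * M * s ^ (-γ)) :=
          setLIntegral_mono' measurableSet_Ioo hptA
      _ = ENNReal.ofReal (KA * M * ((t / 2) ^ (1 - γ) / (1 - γ))) := by
          rw [← ofReal_integral_eq_lintegral_ofReal (hioA.const_mul _)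
            ((ae_restrict_iff' measurableSet_Ioo).2 (Eventually.of_forall fun s hs =>
              mul_nonneg (by positivity) (Real.rpow_nonneg hs.1.le _))),
            integral_const_mul, hintA]
  -- ### part B: `s ≥ t/2`
  have hptB : ∀ s ∈ Ico (t / 2) t, f s ≤ ENNReal.ofReal (A * Real.exp (-(c * (t - s) * 2 ^ (2 * j))) *
      (t - s) ^ (-(1 / 2 : ℝ))) * ENNReal.ofReal (M * (t / 2) ^ (-γ)) := by
    intro s hs
    simp only [hf]
    exact mul_le_mul_right (ENNReal.ofReal_le_ofReal (mul_le_mul_of_nonneg_left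
      (Real.rpow_le_rpow_of_nonpos ht2 hs.1 (neg_nonpos.2 hγ0)) hM)) _
  have hpartB : ∫⁻ s in Ico (t / 2) t, f s ≤
      ENNReal.ofReal (A * (M * (t / 2) ^ (-γ)) * (Real.sqrt Real.pi * (c * 2 ^ (2 * j)) ^ (-(1 / 2 : ℝ)))) := by
    calc ∫⁻ s in Ico (t / 2) t, f s
        ≤ ∫⁻ s in Ico (t / 2) t, ENNReal.ofReal (A * Real.exp (-(c * (t - s) * 2 ^ (2 * j))) *
            (t - s) ^ (-(1 / 2 : ℝ))) * ENNReal.ofReal (M * (t / 2) ^ (-γ)) :=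
          setLIntegral_mono' measurableSet_Ico hptB
      _ ≤ ∫⁻ s in Ioo (t / 4) t, ENNReal.ofReal (A * Real.exp (-(c * (t - s) * 2 ^ (2 * j))) *
            (t - s) ^ (-(1 / 2 : ℝ))) * ENNReal.ofReal (M * (t / 2) ^ (-γ)) :=
          lintegral_mono_set (fun s hs => ⟨by linarith [hs.1], hs.2⟩)
      _ ≤ _ := lintegral_Ioo_high_const_le_gamma hc hA (mul_nonneg hM (Real.rpow_nonneg ht2.le _)) j
  -- ### add up
  rw [hsplit]
  refine (add_le_add hpartA hpartB).trans (le_of_eq ?_)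
  have hπ : 0 ≤ Real.sqrt Real.pi * (c * 2 ^ (2 * j)) ^ (-(1 / 2 : ℝ)) :=
    mul_nonneg (Real.sqrt_nonneg _)
      (Real.rpow_nonneg (mul_nonneg hc.le (zpow_nonneg (by norm_num : (0 : ℝ) ≤ 2) _)) _)
  rw [← ENNReal.ofReal_add (by positivity)
    (mul_nonneg (mul_nonneg hA (mul_nonneg hM (Real.rpow_nonneg ht2.le _))) hπ)]
  congr 1
  rw [hKA]
  ring

end TimeIntegrals

/-! ## Two-sided dyadic sums of an `ℓ¹` profile -/

section DyadicProfile

/-- **Uniform bound for two-sided dyadic sums of a profile** (twin of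
`FunctionSpaces.exists_tsum_rpow_mul_exp_neg_le` with a power decay at infinity): if `h ≥ 0`
satisfies `h(x) ≤ x^a` for `x ≥ 0` and `h(x) ≤ M x^{-b}` for `x ≥ 1` with `a, b > 0`, then
`∑_{j ∈ ℤ} h(4^j t) ≤ K < ∞` for all `t > 0` (choose `j₀` with `4^{j₀}t ∈ [1/4, 1)`; both tails are
geometric). [folklore] -/
theorem exists_tsum_dyadic_profile_le {a b M : ℝ} (ha : 0 < a) (hb : 0 < b) (hM0 : 0 ≤ M) {h : ℝ → ℝ}
    (hb1 : ∀ x, 0 ≤ x → h x ≤ x ^ a) (hb2 : ∀ x, 1 ≤ x → h x ≤ M * x ^ (-b)) :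
    ∃ K : ℝ≥0∞, K ≠ ⊤ ∧ ∀ t : ℝ, 0 < t → ∑' j : ℤ, ENNReal.ofReal (h ((4 : ℝ) ^ j * t)) ≤ K := by
  set ρ : ℝ≥0∞ := ENNReal.ofReal ((4 : ℝ) ^ (-a)) with hρ
  have hρ1 : ρ < 1 := by
    rw [hρ, ENNReal.ofReal_lt_one]
    exact Real.rpow_lt_one_of_one_lt_of_neg (by norm_num) (neg_neg_of_pos ha)
  set ρ' : ℝ≥0∞ := ENNReal.ofReal ((4 : ℝ) ^ (-b)) with hρ'
  have hρ'1 : ρ' < 1 := by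
    rw [hρ', ENNReal.ofReal_lt_one]
    exact Real.rpow_lt_one_of_one_lt_of_neg (by norm_num) (neg_neg_of_pos hb)
  set A : ℝ≥0∞ := ENNReal.ofReal (max 1 M * (4 : ℝ) ^ b) with hA
  refine ⟨A * (1 - ρ')⁻¹ + (1 - ρ)⁻¹, ?_, fun t ht => ?_⟩
  · have h1 : (1 - ρ)⁻¹ ≠ ⊤ := ENNReal.inv_ne_top.2 (tsub_pos_of_lt hρ1).ne'
    have h2 : (1 - ρ')⁻¹ ≠ ⊤ := ENNReal.inv_ne_top.2 (tsub_pos_of_lt hρ'1).ne'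
    exact ENNReal.add_ne_top.2 ⟨ENNReal.mul_ne_top ENNReal.ofReal_ne_top h2, h1⟩
  -- choose `j₀` with `4^{j₀} t ∈ [1/4, 1)`
  obtain ⟨m, hm⟩ := exists_mem_Ico_zpow ht (by norm_num : (1 : ℝ) < 4)
  set j₀ : ℤ := -m - 1 with hj₀
  set x₀ : ℝ := (4 : ℝ) ^ j₀ * t with hx₀
  have hx₀1 : x₀ < 1 := by
    have := hm.2
    rw [hx₀, hj₀, show -m - 1 = -(m + 1) by ring, zpow_neg, inv_mul_lt_iff₀ (zpow_pos (by norm_num) _)]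
    simpa using this
  have hx₀4 : 4⁻¹ ≤ x₀ := by
    have := hm.1
    rw [hx₀, hj₀, show -m - 1 = -(m + 1) by ring, zpow_neg, le_inv_mul_iff₀ (zpow_pos (by norm_num) _),
      zpow_add_one₀ (by norm_num : (4 : ℝ) ≠ 0)]
    linarith
  have hx₀0 : 0 < x₀ := lt_of_lt_of_le (by norm_num) hx₀4
  -- reindex `j = k + j₀`
  have hshift : ∑' j : ℤ, ENNReal.ofReal (h ((4 : ℝ) ^ j * t)) =
      ∑' k : ℤ, ENNReal.ofReal (h ((4 : ℝ) ^ k * x₀)) := by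
    rw [← (Equiv.addRight j₀).tsum_eq]
    congr 1
    funext k
    simp only [Equiv.coe_addRight, hx₀]
    rw [zpow_add₀ (by norm_num : (4 : ℝ) ≠ 0), mul_assoc, mul_comm ((4 : ℝ) ^ j₀) _, ← mul_assoc,
      mul_right_comm]
  -- bounds on the two tails
  have hpos : ∀ k : ℕ, ENNReal.ofReal (h ((4 : ℝ) ^ (k : ℤ) * x₀)) ≤ A * ρ' ^ k := by
    intro k
    have hx : 0 ≤ (4 : ℝ) ^ (k : ℤ) * x₀ := by positivity
    rw [hA, hρ', ← ENNReal.ofReal_pow (Real.rpow_nonneg (by norm_num) _), ← ENNReal.ofReal_mul (by positivity)]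
    refine ENNReal.ofReal_le_ofReal ?_
    rw [← Real.rpow_natCast, ← Real.rpow_mul (by norm_num), zpow_natCast]
    rcases le_or_gt 1 ((4 : ℝ) ^ k * x₀) with h1 | h1
    · refine (hb2 _ h1).trans ?_
      have hxlow : (4 : ℝ) ^ k * 4⁻¹ ≤ (4 : ℝ) ^ k * x₀ := by gcongr
      have hk4 : 0 < (4 : ℝ) ^ k * 4⁻¹ := by positivity
      calc M * ((4 : ℝ) ^ k * x₀) ^ (-b) ≤ M * ((4 : ℝ) ^ k * 4⁻¹) ^ (-b) :=
            mul_le_mul_of_nonneg_left (Real.rpow_le_rpow_of_nonpos hk4 hxlow (neg_nonpos.2 hb.le)) hM0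
        _ = M * (4 : ℝ) ^ b * (4 : ℝ) ^ (-b * k) := by
            rw [Real.mul_rpow (by positivity) (by norm_num), Real.inv_rpow (by norm_num),
              ← Real.rpow_neg (by norm_num), neg_neg, ← Real.rpow_natCast,
              ← Real.rpow_mul (by norm_num)]
            ring_nf
        _ ≤ max 1 M * (4 : ℝ) ^ b * (4 : ℝ) ^ (-b * k) := by
            gcongr
            exact le_max_right _ _
    · have hk : k = 0 := by
        by_contra hk
        have hk1 : 1 ≤ k := Nat.one_le_iff_ne_zero.2 hk
        have : (1 : ℝ) ≤ (4 : ℝ) ^ k * x₀ := by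
          calc (1 : ℝ) = 4 ^ 1 * 4⁻¹ := by norm_num
            _ ≤ (4 : ℝ) ^ k * x₀ := by
                gcongr
                · norm_num
        linarith
      subst hk
      simp only [pow_zero, one_mul, CharP.cast_eq_zero, mul_zero, Real.rpow_zero, mul_one]
      calc h x₀ ≤ x₀ ^ a := hb1 x₀ hx₀0.le
        _ ≤ 1 := Real.rpow_le_one hx₀0.le hx₀1.le ha.le
        _ ≤ max 1 M * (4 : ℝ) ^ b := by
            have h4 : (1 : ℝ) ≤ (4 : ℝ) ^ b := Real.one_le_rpow (by norm_num) hb.le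
            nlinarith [le_max_left (1 : ℝ) M]
  have hneg : ∀ k : ℕ, ENNReal.ofReal (h ((4 : ℝ) ^ (-((k : ℤ) + 1)) * x₀)) ≤ ρ ^ k := by
    intro k
    have hx : 0 ≤ (4 : ℝ) ^ (-((k : ℤ) + 1)) * x₀ := by positivity
    rw [hρ, ← ENNReal.ofReal_pow (Real.rpow_nonneg (by norm_num) _)]
    refine ENNReal.ofReal_le_ofReal ((hb1 _ hx).trans ?_)
    rw [← Real.rpow_natCast, ← Real.rpow_mul (by norm_num)]
    have hxle : (4 : ℝ) ^ (-((k : ℤ) + 1)) * x₀ ≤ (4 : ℝ) ^ (-((k : ℤ) + 1)) :=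
      mul_le_of_le_one_right (zpow_nonneg (by norm_num) _) hx₀1.le
    calc ((4 : ℝ) ^ (-((k : ℤ) + 1)) * x₀) ^ a ≤ ((4 : ℝ) ^ (-((k : ℤ) + 1))) ^ a :=
          Real.rpow_le_rpow hx hxle ha.le
      _ = (4 : ℝ) ^ (-a * (k + 1)) := by
          rw [← Real.rpow_intCast, ← Real.rpow_mul (by norm_num)]
          push_cast
          ring_nf
      _ ≤ (4 : ℝ) ^ (-a * k) := by
          refine Real.rpow_le_rpow_of_exponent_le (by norm_num) ?_
          nlinarith
  rw [hshift, tsum_of_nat_of_neg_add_one ENNReal.summable ENNReal.summable]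
  gcongr
  · calc ∑' k : ℕ, ENNReal.ofReal (h ((4 : ℝ) ^ (k : ℤ) * x₀)) ≤ ∑' k : ℕ, A * ρ' ^ k :=
          ENNReal.tsum_le_tsum hpos
      _ = A * (1 - ρ')⁻¹ := by rw [ENNReal.tsum_mul_left, ENNReal.tsum_geometric]
  · calc ∑' k : ℕ, ENNReal.ofReal (h ((4 : ℝ) ^ (-((k : ℤ) + 1)) * x₀)) ≤ ∑' k : ℕ, ρ ^ k :=
          ENNReal.tsum_le_tsum hneg
      _ = (1 - ρ)⁻¹ := ENNReal.tsum_geometric ρ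

/-- The profile `min(x^a, M x^{-b})` satisfies the hypotheses of `exists_tsum_dyadic_profile_le`.
[folklore] -/
theorem min_rpow_le_bounds {a b M : ℝ} :
    (∀ x : ℝ, 0 ≤ x → min (x ^ a) (M * x ^ (-b)) ≤ x ^ a) ∧
      ∀ x : ℝ, 1 ≤ x → min (x ^ a) (M * x ^ (-b)) ≤ M * x ^ (-b) :=
  ⟨fun _ _ => min_le_left _ _, fun _ _ => min_le_right _ _⟩

end DyadicProfile

end Literature.Analysis.FluidPDE

end
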